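import Literature.InformationTheory.QuantumCodes.TwoBlockCodeEquivalences
import Literature.InformationTheory.QuantumCodes.AbelianTwoBlockPaddedLogicals
import HarnessLib

/-!
# Quotient maps of abelian two-block codes: `k` can only grow in a cover, and `d ≤ [G : G'] · d'`
# along surjections of ODD index (pull-backs of logical operators)

A structural lemma of the qec cell's candidate-generation row (qec-search-8, «algebraic lifts»); tier KERNEL
(all statements PROVED, axioms standard, no `native_decide`, no certificate, no kit). HONEST FRAMING: elementary
linear algebra; NOT located in print in this form (presearch recorded on the cell's STATUS 2026-08-27, corpus +
galaxy: nearest are the parameter-PRESERVING maps of Wang–Pryadko 2022 Statement 3 and the commensurate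
inflation / coset decomposition of Statement 4 = Lin–Pryadko 2024 §4.3, both the SUBGROUP direction and both
in the tree — `TwoBlockCodeEquivalences`, `TwoBlockUnitFactor`, `TwoBlockCosetDecomposition`; for CYCLIC `G` the
`x ↦ x^h` / repeated-code maps are discussed in Wang–Pryadko 2022 §3.2–3.3 around Statements 3–4 and 10,
arXiv:2203.17216 — qec-lit-3's pointer; no printed statement of the odd-`|ker φ|` non-triviality clause for a
general abelian `G` is known to the cell); tagged `[folklore]`, no priority or novelty word is attached. The
distance clause NEEDS `|ker φ|` odd: for even index the fibre sum kills pull-backs (`φ_! φ^* = 0` over `𝔽₂`) and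
this file says nothing about distances there.

Setting: the tree's abelian two-block CSS code `AbelianTwoBlock.css a b` (`H_X = [A|B]`, `H_Z = [Bᵀ|Aᵀ]`,
`A = circulant a`, `B = circulant b` over `𝔽₂`, qubits `G ⊕ G`) for a finite abelian group `G`, and an additive
map `φ : G →+ G'` to another finite abelian group. The group-algebra map `𝔽₂[G] → 𝔽₂[G']` induced by `φ` is
the PUSH-FORWARD of coefficient vectors, `(φ_* a) g' = Σ_{φ g = g'} a g` (`push`); the QUOTIENT CODE of
`(a, b)` along `φ` is `css (φ_* a) (φ_* b)` over `G'`. On qubit vectors there are two maps: the PULL-BACK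
`φ^* v = v ∘ (φ ⊕ φ)` (`pull`, from the quotient code up) and the FIBRE SUM `φ_! w` (`fold`, blockwise
push-forward, down). Results (`Summit.Ventures.QEC.AbelianTwoBlock.*`):

* `HX_mulVec_pull`, `HZ_mulVec_pull`: `H_X(a,b) (φ^* v) = (H_X(φ_*a, φ_*b) v) ∘ φ` and likewise for `H_Z` —
  pull-backs of vectors with zero syndrome have zero syndrome;
* **`css_k_push_le`**: for every SURJECTIVE `φ`, `k(φ_* a, φ_* b) ≤ k(a, b)` — by `k = 2·dim(ker A ∩ ker B)`
  (`AbelianTwoBlock.css_k_eq`, Literature) and the injection `u ↦ u ∘ φ : ker Ā ∩ ker B̄ ↪ ker A ∩ ker B`.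
  NO parity hypothesis: the dimension never drops when passing from a quotient code to its cover;
* `push_circulant_mulVec` (`φ_*` is multiplicative for convolution) ⇒ `fold_mem_rowSpZ`: the fibre sum maps
  `rs H_Z(a,b)` into `rs H_Z(φ_*a, φ_*b)`; `fold_pull`: `φ_! φ^* v = |ker φ| · v`; `hammingNorm_pull`:
  `|φ^* v| = |ker φ| · |v|` (`fibreCard φ = #{g : φ g = 0}`, the size of every fibre, `card_fibre`);
* **`pull_zLogical`**: if `φ` is surjective with `|ker φ|` ODD, the pull-back of a `Z`-logical operator of the
  quotient code (`H_X v = 0`, `v ∉ rs H_Z`) is a `Z`-logical operator of `css a b` of weight `|ker φ|·|v|`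
  (non-triviality: `φ_! φ^* v = v` over `𝔽₂` when the index is odd, and `φ_!` preserves `Z`-stabilizers);
* **`css_dZ_le_mul_dZ_push`, `css_dX_le_mul_dX_push`**: hence `d_Z(a,b) ≤ |ker φ| · d_Z(φ_*a, φ_*b)` and the
  same for `d_X` (`d_X = d_Z` on both sides), whenever the quotient code is non-trivial (`k' > 0`, so that
  its distance is attained; then `0 < k' ≤ k`, `css_k_pos_of_push`).

Bivariate-bicycle phrasing (`Summit.Ventures.QEC.BB.*`, companion file `Census/BB/BBQuotientMaps.lean`):
`pushforward φ C = QC(φ_* A, φ_* B)` for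
`C = QC(A, B) : BB.Code ℓ m` and `φ : ℤ_ℓ × ℤ_m →+ ℤ_ℓ' × ℤ_m'` (`pushforward_css`, `coeffVec_push`);
`k_pushforward_le`, `dZ_le_of_quotient_logical`, `d_le_mul_d_pushforward`; the reduction maps
`torusHom L M l m : ℤ_L × ℤ_M ↠ ℤ_l × ℤ_m` (`l ∣ L`, `m ∣ M`; `(a, b) ↦ (a mod l, b mod m)`, along which every
pure-power BB code `QC(A, B)` on the big torus covers `QC(A mod, B mod)` on the small one — exponents reduced,
colliding monomials cancelling mod 2), `torusHom_surjective`, and **`fibreCard_torusHom`: index `(L/l)·(M/m)`**.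

What this gives the census (plan/CENSUS-PREREG grid A, candidate generation Q1): (i) a zero-cost LOWER bound on
`k` of a big two-block code from any of its quotients and an upper bound on `k` of a quotient from its cover;
(ii) for odd index, certified distance UPPER bounds transfer up the divisibility lattice of `(ℓ, m)`:
`d(QC over ℤ_{hℓ'} × ℤ_m) ≤ h · d(QC over ℤ_ℓ' × ℤ_m)` for odd `h` — e.g. among the printed codes of Bravyi et
al. 2024 Table 3, `BB360 = QC(x⁹+y+y², y³+x²⁵+x²⁶)` on `ℤ₃₀ × ℤ₆` reduces mod `x⁶` to `BB72` (index 5, odd: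
`k(BB360) ≥ k(BB72) = 12`, `d(BB360) ≤ 5·6 = 30`), and `BB90` on `ℤ₁₅ × ℤ₃` reduces to an `[[18, 8, 2]]` code
on `ℤ₃ × ℤ₃` (index 5: `d(BB90) ≤ 10`, which is its true distance) — worked instances are filed separately
(`Census/BB/BBQuotientCovers.lean`); (iii) a pruning rule for lifted-code search: an odd `h`-fold cover gains
at most a factor `h` in distance over its base. For EVEN index the non-triviality step fails (`φ_! φ^* = 0`) and
no distance statement is made (e.g. `BB144 → BB72`, index 2, where `2·6 = 12` happens to hold, is NOT an
instance of this file).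
-/

namespace Summit.Ventures.QEC

open Matrix Literature.InformationTheory.QuantumCodes
open Literature.InformationTheory.QuantumCodes.AbelianTwoBlock

namespace AbelianTwoBlock

variable {G G' : Type*} [Fintype G] [AddCommGroup G] [DecidableEq G]
  [Fintype G'] [AddCommGroup G'] [DecidableEq G']

/-! ### Push-forward of coefficient vectors, pull-back and fibre sum of qubit vectors -/

/-- The push-forward `φ_* a` of a coefficient vector along `φ : G →+ G'`:
`(φ_* a) g' = Σ_{g : φ g = g'} a g` — the group-algebra map `𝔽₂[G] → 𝔽₂[G']` induced by `φ`
(monomials `g ↦ φ g`, coefficients added mod 2). (definition) -/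
def push (φ : G →+ G') (a : G → ZMod 2) : G' → ZMod 2 :=
  fun g' => ∑ g, if φ g = g' then a g else 0

/-- The pull-back of a qubit vector of the code over `G'` to the code over `G`: constant on the fibres
of `φ` in each of the two blocks, `(φ^* v) (L g) = v (L (φ g))`, `(φ^* v) (R g) = v (R (φ g))`.
(definition) -/
def pull (φ : G →+ G') (v : G' ⊕ G' → ZMod 2) : G ⊕ G → ZMod 2 :=
  v ∘ Sum.map φ φ

/-- The fibre sum of a qubit vector of the code over `G`: the blockwise push-forward
`(φ_! w) (L g') = Σ_{φ g = g'} w (L g)`, `(φ_! w) (R g') = Σ_{φ g = g'} w (R g)`. (definition) -/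
def fold (φ : G →+ G') (w : G ⊕ G → ZMod 2) : G' ⊕ G' → ZMod 2 :=
  Sum.elim (push φ (w ∘ Sum.inl)) (push φ (w ∘ Sum.inr))

/-- The number of elements in the zero fibre of `φ` (`= |ker φ|`; for a surjection, the index
`[G : G'] = |G| / |G'|` and the size of EVERY fibre, `card_fibre`). (definition) -/
def fibreCard (φ : G →+ G') : ℕ :=
  (Finset.univ.filter fun g : G => φ g = 0).card

omit [Fintype G'] [DecidableEq G] in
/-- The defining property of the push-forward: `Σ_{g'} (φ_* c) g' · f g' = Σ_g c g · f (φ g)`. [folklore] -/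
theorem sum_push_mul [Fintype G'] (φ : G →+ G') (c : G → ZMod 2) (f : G' → ZMod 2) :
    ∑ g', push φ c g' * f g' = ∑ g, c g * f (φ g) := by
  simp only [push, Finset.sum_mul]
  rw [Finset.sum_comm]
  refine Finset.sum_congr rfl fun g _ => ?_
  simp only [ite_mul, zero_mul]
  rw [Finset.sum_ite_eq]
  simp

omit [DecidableEq G] in
/-- Convolution sums fold along `φ`: `Σ_h c (g − h) · u (φ h) = Σ_{h'} (φ_* c) (φ g − h') · u h'`. [folklore] -/
theorem sum_sub_mul_comp (φ : G →+ G') (c : G → ZMod 2) (u : G' → ZMod 2) (g : G) :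
    ∑ h, c (g - h) * u (φ h) = ∑ h', push φ c (φ g - h') * u h' := by
  have h1 : ∑ h, c (g - h) * u (φ h) = ∑ h, c h * u (φ g - φ h) :=
    Fintype.sum_equiv (Equiv.subLeft g) _ _ fun h => by simp [map_sub]
  have h2 : ∑ h', push φ c (φ g - h') * u h' = ∑ h', push φ c h' * u (φ g - h') :=
    Fintype.sum_equiv (Equiv.subLeft (φ g)) _ _ fun h' => by simp
  rw [h1, h2, sum_push_mul]

omit [DecidableEq G] in
/-- The transposed convolution sums fold likewise: `Σ_h c (h − g) · u (φ h) = Σ_{h'} (φ_* c) (h' − φ g) · u h'`.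
[folklore] -/
theorem sum_sub_mul_comp' (φ : G →+ G') (c : G → ZMod 2) (u : G' → ZMod 2) (g : G) :
    ∑ h, c (h - g) * u (φ h) = ∑ h', push φ c (h' - φ g) * u h' := by
  have h1 : ∑ h, c (h - g) * u (φ h) = ∑ h, c h * u (φ h + φ g) :=
    Fintype.sum_equiv (Equiv.subRight g) _ _ fun h => by simp [map_sub]
  have h2 : ∑ h', push φ c (h' - φ g) * u h' = ∑ h', push φ c h' * u (h' + φ g) :=
    Fintype.sum_equiv (Equiv.subRight (φ g)) _ _ fun h' => by simp
  rw [h1, h2, sum_push_mul]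

/-! ### The check matrices intertwine pull-back with the quotient code -/

omit [DecidableEq G] in
/-- One block: `A (u ∘ φ) = (Ā u) ∘ φ` for `A = circulant a`, `Ā = circulant (φ_* a)`. [folklore] -/
theorem circulant_mulVec_comp (φ : G →+ G') (a : G → ZMod 2) (u : G' → ZMod 2) :
    circulant a *ᵥ (u ∘ φ) = (circulant (push φ a) *ᵥ u) ∘ φ := by
  funext g
  simp only [Matrix.mulVec, dotProduct, circulant_apply, Function.comp_apply]
  exact sum_sub_mul_comp φ a u g

omit [DecidableEq G] in
/-- **`H_X` intertwines**: `H_X(a,b) (φ^* v) = (H_X(φ_* a, φ_* b) v) ∘ φ`. In particular the pull-back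
of a vector with zero `X`-syndrome in the quotient code has zero `X`-syndrome. [folklore] -/
theorem HX_mulVec_pull (φ : G →+ G') (a b : G → ZMod 2) (v : G' ⊕ G' → ZMod 2) :
    HX a b *ᵥ pull φ v = (HX (push φ a) (push φ b) *ᵥ v) ∘ φ := by
  funext g
  simp only [Matrix.mulVec, dotProduct, Fintype.sum_sum_type, HX_apply_inl, HX_apply_inr, pull,
    Function.comp_apply, Sum.map_inl, Sum.map_inr]
  rw [sum_sub_mul_comp φ a (fun x => v (Sum.inl x)) g, sum_sub_mul_comp φ b (fun x => v (Sum.inr x)) g]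

omit [DecidableEq G] in
/-- **`H_Z` intertwines**: `H_Z(a,b) (φ^* v) = (H_Z(φ_* a, φ_* b) v) ∘ φ`. [folklore] -/
theorem HZ_mulVec_pull (φ : G →+ G') (a b : G → ZMod 2) (v : G' ⊕ G' → ZMod 2) :
    HZ a b *ᵥ pull φ v = (HZ (push φ a) (push φ b) *ᵥ v) ∘ φ := by
  funext g
  simp only [Matrix.mulVec, dotProduct, Fintype.sum_sum_type, HZ_apply_inl, HZ_apply_inr, pull,
    Function.comp_apply, Sum.map_inl, Sum.map_inr]
  rw [sum_sub_mul_comp' φ b (fun x => v (Sum.inl x)) g, sum_sub_mul_comp' φ a (fun x => v (Sum.inr x)) g]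

/-! ### `k` is monotone: the quotient code has at most as many logical qubits -/

omit [DecidableEq G] in
/-- Pull-back maps `ker Ā ∩ ker B̄` into `ker A ∩ ker B` (one block at a time). [folklore] -/
theorem comp_mem_kerInter (φ : G →+ G') (a b : G → ZMod 2) {u : G' → ZMod 2}
    (hu : u ∈ LinearMap.ker (circulant (push φ a)).mulVecLin ⊓ LinearMap.ker (circulant (push φ b)).mulVecLin) :
    u ∘ φ ∈ LinearMap.ker (circulant a).mulVecLin ⊓ LinearMap.ker (circulant b).mulVecLin := by
  simp only [Submodule.mem_inf, LinearMap.mem_ker, Matrix.mulVecLin_apply] at hu ⊢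
  rw [circulant_mulVec_comp, circulant_mulVec_comp, hu.1, hu.2]
  exact ⟨rfl, rfl⟩

/-- **Monotonicity of the dimension under quotients**: for every SURJECTIVE `φ : G ↠ G'` and every pair
`(a, b)`, `k(φ_* a, φ_* b) ≤ k(a, b)` — the quotient two-block code has at most as many logical qubits
(`k = 2 · dim (ker A ∩ ker B)` on both sides and `u ↦ u ∘ φ` is an injection `ker Ā ∩ ker B̄ ↪ ker A ∩ ker B`).
No parity hypothesis. [folklore] -/
theorem css_k_push_le (φ : G →+ G') (hφ : Function.Surjective φ) (a b : G → ZMod 2) :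
    (css (push φ a) (push φ b)).k ≤ (css a b).k := by
  rw [css_k_eq, css_k_eq]
  refine Nat.mul_le_mul_left 2 ?_
  set K' := LinearMap.ker (circulant (push φ a)).mulVecLin ⊓ LinearMap.ker (circulant (push φ b)).mulVecLin
  set K := LinearMap.ker (circulant a).mulVecLin ⊓ LinearMap.ker (circulant b).mulVecLin
  let f : K' →ₗ[ZMod 2] K :=
    (LinearMap.funLeft (ZMod 2) (ZMod 2) φ).restrict (p := K') (q := K) fun u hu => comp_mem_kerInter φ a b hu
  refine LinearMap.finrank_le_finrank_of_injective (f := f) fun x y hxy => ?_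
  apply Subtype.ext
  have h := congrArg Subtype.val hxy
  exact LinearMap.funLeft_injective_of_surjective (ZMod 2) (ZMod 2) φ hφ h

/-! ### Fibres, the fibre sum, and the pull-back's weight -/

omit [Fintype G'] [DecidableEq G] in
/-- Every fibre of a surjective homomorphism has `fibreCard φ = |ker φ|` elements. [folklore] -/
theorem card_fibre (φ : G →+ G') (hφ : Function.Surjective φ) (g' : G') :
    (Finset.univ.filter fun g : G => φ g = g').card = fibreCard φ := by
  obtain ⟨g₀, rfl⟩ := hφ g'
  unfold fibreCard
  refine Finset.card_bij (fun g _ => g - g₀) (fun g hg => ?_) (fun g₁ _ g₂ _ h => ?_) (fun k hk => ?_)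
  · simp only [Finset.mem_filter, Finset.mem_univ, true_and] at hg ⊢
    rw [map_sub, hg, sub_self]
  · exact sub_left_injective h
  · simp only [Finset.mem_filter, Finset.mem_univ, true_and] at hk
    refine ⟨k + g₀, ?_, by simp⟩
    simp only [Finset.mem_filter, Finset.mem_univ, true_and, map_add, hk, zero_add]

omit [Fintype G'] [DecidableEq G] in
/-- The push-forward of a pulled-back coefficient vector is `|ker φ| · ` the original. [folklore] -/
theorem push_comp (φ : G →+ G') (hφ : Function.Surjective φ) (u : G' → ZMod 2) :
    push φ (u ∘ φ) = (fibreCard φ : ZMod 2) • u := by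
  funext g'
  simp only [push, Function.comp_apply, Pi.smul_apply, smul_eq_mul]
  have : ∀ g : G, (if φ g = g' then u (φ g) else 0) = if φ g = g' then u g' else 0 := fun g => by
    split_ifs with h
    · rw [h]
    · rfl
  simp only [this]
  rw [← Finset.sum_filter, Finset.sum_const, card_fibre φ hφ g', nsmul_eq_mul]

omit [Fintype G'] [DecidableEq G] in
/-- **Fibre sum of a pull-back**: `φ_! (φ^* v) = |ker φ| · v`. [folklore] -/
theorem fold_pull (φ : G →+ G') (hφ : Function.Surjective φ) (v : G' ⊕ G' → ZMod 2) :
    fold φ (pull φ v) = (fibreCard φ : ZMod 2) • v := by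
  funext q
  rcases q with g' | g'
  · change push φ ((v ∘ Sum.inl) ∘ φ) g' = _
    rw [push_comp φ hφ]; rfl
  · change push φ ((v ∘ Sum.inr) ∘ φ) g' = _
    rw [push_comp φ hφ]; rfl

/-- `|(u, v)| = |u| + |v|`. [folklore] -/
private theorem hammingNorm_sumElim {α β R : Type*} [Fintype α] [Fintype β] [Zero R] [DecidableEq R]
    (u : α → R) (v : β → R) : hammingNorm (Sum.elim u v) = hammingNorm u + hammingNorm v := by
  unfold hammingNorm
  rw [← Finset.card_disjSum]
  congr 1
  ext i
  rcases i with i | i <;> simp [Finset.mem_disjSum]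

omit [DecidableEq G] in
/-- Pulling back one block multiplies the Hamming weight by the fibre size. [folklore] -/
theorem hammingNorm_comp (φ : G →+ G') (hφ : Function.Surjective φ) (u : G' → ZMod 2) :
    hammingNorm (u ∘ φ) = fibreCard φ * hammingNorm u := by
  unfold hammingNorm
  rw [Finset.card_eq_sum_card_fiberwise (f := φ) (t := Finset.univ.filter fun g' : G' => u g' ≠ 0)
    (fun g hg => by simpa using hg)]
  have : ∀ g' ∈ (Finset.univ.filter fun g' : G' => u g' ≠ 0),
      ((Finset.univ.filter fun g : G => (u ∘ φ) g ≠ 0).filter fun g => φ g = g').card = fibreCard φ := by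
    intro g' hg'
    simp only [Finset.mem_filter, Finset.mem_univ, true_and] at hg'
    rw [Finset.filter_filter, ← card_fibre φ hφ g']
    congr 1
    ext g
    simp only [Finset.mem_filter, Finset.mem_univ, true_and, Function.comp_apply, and_iff_right_iff_imp]
    intro h; rwa [h]
  rw [Finset.sum_congr rfl this, Finset.sum_const, smul_eq_mul, mul_comm]

omit [DecidableEq G] in
/-- **Weight of a pull-back**: `|φ^* v| = |ker φ| · |v|`. [folklore] -/
theorem hammingNorm_pull (φ : G →+ G') (hφ : Function.Surjective φ) (v : G' ⊕ G' → ZMod 2) :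
    hammingNorm (pull φ v) = fibreCard φ * hammingNorm v := by
  have hv : v = Sum.elim (v ∘ Sum.inl) (v ∘ Sum.inr) := (Sum.elim_comp_inl_inr v).symm
  have hp : pull φ v = Sum.elim ((v ∘ Sum.inl) ∘ φ) ((v ∘ Sum.inr) ∘ φ) := by
    funext q; rcases q with g | g <;> rfl
  rw [hp, hammingNorm_sumElim, hammingNorm_comp φ hφ, hammingNorm_comp φ hφ]
  conv_rhs => rw [hv, hammingNorm_sumElim]
  ring

/-! ### The fibre sum maps `Z`-stabilizers to `Z`-stabilizers; odd index ⇒ pull-backs of logicals are logicals -/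

omit [DecidableEq G] in
/-- **The push-forward is multiplicative for convolution**: `φ_* (b ⋆ c) = (φ_* b) ⋆ (φ_* c)`, i.e.
`φ_* (circulant b · c) = circulant (φ_* b) · (φ_* c)` (the group-algebra map `𝔽₂[G] → 𝔽₂[G']` is a ring
homomorphism). [folklore] -/
theorem push_circulant_mulVec (φ : G →+ G') (b c : G → ZMod 2) :
    push φ (circulant b *ᵥ c) = circulant (push φ b) *ᵥ push φ c := by
  funext h'
  -- right-hand side: `Σ_{g'} (φ_* b)(h' − g') (φ_* c) g' = Σ_g c g · (φ_* b)(h' − φ g)`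
  have hR : (circulant (push φ b) *ᵥ push φ c) h' = ∑ g, c g * push φ b (h' - φ g) := by
    simp only [Matrix.mulVec, dotProduct, circulant_apply]
    rw [show (∑ g', push φ b (h' - g') * push φ c g') = ∑ g', push φ c g' * push φ b (h' - g') from
      Finset.sum_congr rfl fun _ _ => mul_comm _ _]
    exact sum_push_mul φ c fun x => push φ b (h' - x)
  rw [hR]
  -- left-hand side: `Σ_{φ h = h'} Σ_g b (h − g) c g = Σ_g c g · Σ_{φ h = h'} b (h − g)`
  simp only [push, Matrix.mulVec, dotProduct, circulant_apply]
  rw [← Finset.sum_filter, Finset.sum_comm]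
  refine Finset.sum_congr rfl fun g _ => ?_
  rw [show (∑ h ∈ Finset.univ.filter (fun h : G => φ h = h'), b (h - g) * c g)
      = c g * ∑ h ∈ Finset.univ.filter (fun h : G => φ h = h'), b (h - g) by
    rw [Finset.mul_sum]; exact Finset.sum_congr rfl fun _ _ => mul_comm _ _]
  congr 1
  rw [Finset.sum_filter, ← Finset.sum_filter]
  rw [Finset.sum_filter]
  -- `Σ_h [φ h = h'] b (h − g) = Σ_t [φ t = h' − φ g] b t`, re-indexing `h = t + g`
  refine (Fintype.sum_equiv (Equiv.subRight g) _ _ fun h => ?_)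
  simp only [Equiv.subRight_apply, map_sub]
  by_cases hh : φ h = h'
  · rw [if_pos hh, if_pos (by rw [hh])]
  · rw [if_neg hh, if_neg (fun h2 => hh (by rwa [sub_eq_sub_iff_sub_eq_sub, sub_self, sub_eq_zero] at h2))]

omit [DecidableEq G] in
/-- **The fibre sum maps `rs H_Z(a,b)` into `rs H_Z(φ_* a, φ_* b)`**: `φ_!` of a product of `Z`-checks
of the code over `G` is a product of `Z`-checks of the quotient code (row `g` goes to row `φ g`).
[folklore] -/
theorem fold_mem_rowSpZ (φ : G →+ G') (a b : G → ZMod 2) {w : G ⊕ G → ZMod 2}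
    (hw : w ∈ (css a b).rowSpZ) : fold φ w ∈ (css (push φ a) (push φ b)).rowSpZ := by
  have hw' : Sum.elim (w ∘ Sum.inl) (w ∘ Sum.inr) ∈ LinearMap.range (HZ a b).vecMulLinear := by
    rw [Sum.elim_comp_inl_inr]; exact hw
  obtain ⟨c, hc1, hc2⟩ := (sumElim_mem_range_vecMulLinear_HZ_iff a b _ _).1 hw'
  change Sum.elim (push φ (w ∘ Sum.inl)) (push φ (w ∘ Sum.inr)) ∈
    LinearMap.range (HZ (push φ a) (push φ b)).vecMulLinear
  rw [sumElim_mem_range_vecMulLinear_HZ_iff]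
  exact ⟨push φ c, by rw [← hc1, push_circulant_mulVec], by rw [← hc2, push_circulant_mulVec]⟩

omit [DecidableEq G] in
/-- **Odd index: pull-backs of non-trivial vectors are non-trivial.** If `φ` is surjective with
`|ker φ|` odd and `v ∉ rs H_Z(φ_* a, φ_* b)`, then `φ^* v ∉ rs H_Z(a, b)` — because
`φ_! (φ^* v) = |ker φ| · v = v` would otherwise lie in `rs H_Z(φ_* a, φ_* b)`. [folklore] -/
theorem pull_not_mem_rowSpZ (φ : G →+ G') (hφ : Function.Surjective φ) (hodd : Odd (fibreCard φ))
    (a b : G → ZMod 2) {v : G' ⊕ G' → ZMod 2} (hv : v ∉ (css (push φ a) (push φ b)).rowSpZ) :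
    pull φ v ∉ (css a b).rowSpZ := by
  intro h
  have h2 := fold_mem_rowSpZ φ a b h
  rw [fold_pull φ hφ, ZMod.natCast_eq_one_iff_odd.2 hodd, one_smul] at h2
  exact hv h2

omit [DecidableEq G] in
/-- **Pull-back of a `Z`-logical along an odd-index surjection is a `Z`-logical of `|ker φ|` times the
weight**: for `φ : G ↠ G'` with `|ker φ|` odd, every `v` with `H_X(φ_* a, φ_* b) v = 0`,
`v ∉ rs H_Z(φ_* a, φ_* b)` gives `φ^* v` with `H_X(a,b) (φ^* v) = 0`, `φ^* v ∉ rs H_Z(a,b)` and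
`|φ^* v| = |ker φ| · |v|`. [folklore] -/
theorem pull_zLogical (φ : G →+ G') (hφ : Function.Surjective φ) (hodd : Odd (fibreCard φ))
    (a b : G → ZMod 2) {v : G' ⊕ G' → ZMod 2} (hv : (css (push φ a) (push φ b)).HX *ᵥ v = 0)
    (hv' : v ∉ (css (push φ a) (push φ b)).rowSpZ) :
    (css a b).HX *ᵥ pull φ v = 0 ∧ pull φ v ∉ (css a b).rowSpZ ∧
      hammingNorm (pull φ v) = fibreCard φ * hammingNorm v := by
  refine ⟨?_, pull_not_mem_rowSpZ φ hφ hodd a b hv', hammingNorm_pull φ hφ v⟩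
  rw [css_HX] at hv ⊢
  rw [HX_mulVec_pull, hv]
  rfl

omit [DecidableEq G] in
/-- **`d_Z ≤ |ker φ| · d_Z'` along an odd-index surjection.** For `φ : G ↠ G'` with `|ker φ|` odd and
the quotient code non-trivial (`k' > 0`, so that `d_Z'` is attained by a logical operator),
`d_Z(a, b) ≤ |ker φ| · d_Z(φ_* a, φ_* b)`. [folklore] -/
theorem css_dZ_le_mul_dZ_push (φ : G →+ G') (hφ : Function.Surjective φ) (hodd : Odd (fibreCard φ))
    (a b : G → ZMod 2) (hk : 0 < (css (push φ a) (push φ b)).k) :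
    (css a b).dZ ≤ fibreCard φ * (css (push φ a) (push φ b)).dZ := by
  set C' := css (push φ a) (push φ b)
  obtain ⟨v, hv, hv', hvd⟩ := C'.exists_hammingNorm_eq_dZ ((C'.dZ_pos_iff).1 (C'.dZ_pos_of_k_pos hk))
  obtain ⟨h1, h2, h3⟩ := pull_zLogical φ hφ hodd a b hv hv'
  calc (css a b).dZ ≤ hammingNorm (pull φ v) := (css a b).dZ_le_hammingNorm h1 h2
    _ = fibreCard φ * C'.dZ := by rw [h3, hvd]

omit [DecidableEq G] in
/-- **`d_X ≤ |ker φ| · d_X'`** likewise (both codes have `d_X = d_Z`, `AbelianTwoBlock.css_dX_eq_dZ`).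
[folklore] -/
theorem css_dX_le_mul_dX_push (φ : G →+ G') (hφ : Function.Surjective φ) (hodd : Odd (fibreCard φ))
    (a b : G → ZMod 2) (hk : 0 < (css (push φ a) (push φ b)).k) :
    (css a b).dX ≤ fibreCard φ * (css (push φ a) (push φ b)).dX := by
  rw [css_dX_eq_dZ, css_dX_eq_dZ]
  exact css_dZ_le_mul_dZ_push φ hφ hodd a b hk

/-- And the quotient of a code with `k' > 0` has `0 < k' ≤ k`: both codes are non-trivial. [folklore] -/
theorem css_k_pos_of_push (φ : G →+ G') (hφ : Function.Surjective φ) (a b : G → ZMod 2)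
    (hk : 0 < (css (push φ a) (push φ b)).k) : 0 < (css a b).k :=
  hk.trans_le (css_k_push_le φ hφ a b)

omit [Fintype G'] [DecidableEq G] in
/-- The push-forward is additive. [folklore] -/
theorem push_add (φ : G →+ G') (a b : G → ZMod 2) : push φ (a + b) = push φ a + push φ b := by
  funext g'
  simp only [push, Pi.add_apply, ← Finset.sum_add_distrib]
  refine Finset.sum_congr rfl fun g _ => ?_
  split_ifs <;> simp

omit [Fintype G'] in
/-- The push-forward of a monomial is the monomial of the image: `φ_* (δ_g) = δ_{φ g}`. [folklore] -/
theorem push_single (φ : G →+ G') (g : G) (c : ZMod 2) : push φ (Pi.single g c) = Pi.single (φ g) c := by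
  funext g'
  simp only [push]
  rw [Finset.sum_eq_single g]
  · by_cases h : φ g = g'
    · rw [if_pos h, Pi.single_eq_same, ← h, Pi.single_eq_same]
    · rw [if_neg h, Pi.single_eq_of_ne (Ne.symm h)]
  · intro x _ hx
    rw [Pi.single_eq_of_ne hx]; split_ifs <;> rfl
  · intro h; exact absurd (Finset.mem_univ g) h

end AbelianTwoBlock

end Summit.Ventures.QEC
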